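import Literature.AlgebraicGeometry.Frobenioids.Thm36SubProofs
import Literature.AlgebraicGeometry.Frobenioids.Thm36SubProofs2
import Literature.AlgebraicGeometry.Frobenioids.PadicFrobenioidZeroMonoid
import HarnessLib

/-!
# Frobenioids II, Example 3.3 (ii) / Theorem 3.6 (i) for `C^ℝ := C^rlf`: THE realification of the archimedean
# Frobenioid IS A FROBENIOID — the hypotheses of [FrdI] Thm. 5.2 discharged for the realified archimedean data

Mochizuki, *The geometry of Frobenioids II: poly-Frobenioids*, Kyushu J. Math. **62** (2008) 401–460, §3,
Example 3.3 (ii), kurims text `paper:url-4322d76898e0` p. 28: "`C^ℝ := C^rlf` [cf. [Mzk5], Proposition 5.3]" and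
Theorem 3.6 (i) p. 36 "The Frobenioid `(C^Λ)^istr` …" (for `Λ = ℝ`, `(C^ℝ)^istr = C^ℝ`); [FrdI] Prop. 5.3 p. 103:
"the realification `C^rlf` of the Frobenioid `C` [is] the model Frobenioid [cf. Theorem 5.2, (ii)] associated to
the divisor monoid `Φ^rlf` … and the rational function monoid `ℝ · Φ^birat`", Thm. 5.2 (ii) p. 101: the model
Frobenioid of such data over a connected, totally epimorphic base IS a Frobenioid
[cite: MochizukiFrdII2008, Ex 3.3 (ii) p.28] [cite: MochizukiFrdI2008, Prop. 5.3 p.103].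

PROOF-ONLY companion of the sub-DAG statements file `Thm36Sub.lean` (abc-iut cell, layer L1, row M13; seat
abc-iut-w5-d161): for THE realification `rlfCat π` / `rlfStr π` of the archimedean Frobenioid
`C = C₀ ×_{D₀} D → F_Φ` of Example 3.3 over a base `π : D → D₀` we DISCHARGE the hypotheses of [FrdI]
Thm. 5.2 (the tree's `ModelFrobenioid.isFrobenioid`, seat abc-iut-found) at the realified data
`(Φ^rlf, ℝ · Φ^birat ↪ (Φ^rlf)^gp)`:
* `isMonoidOn_rlfFunctor_Φ` — `Φ^rlf` is a monoid on `D`: its pull-backs are identities (`Φ = ℝ_{≥0}` is the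
  constant monoid; d074's `rlfFunctor_Φ_map_apply`), characteristically injective since `Φ^rlf(X)` is sharp;
* `isMonoidOn_realSpan` — `ℝ · Φ^birat` is a monoid on `D`: its pull-backs restrict the identities
  `(Φ^rlf)^gp(f)` (`pullGp_rlf_eq`) between the FULL subgroups (`realSpan_carrier_eq_top`), and a group-like
  monoid has a one-element monoid of associates (`associates_eq_of_isUnit`);
* divisoriality of `Φ^rlf` is [FrdI] Def. 2.4 (i) (`IsPerfFactorial.Rlf.isDivisorial`); `ℝ · Φ^birat` is
  group-like (`rlf_objectwise_isGroupLike`, d074);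
hence **`rlf_isFrobenioid`: `C^ℝ = C^rlf` is a Frobenioid** under print's standing hypotheses on the base
("`D` connected, totally epimorphic", [FrdII] Ex. 3.3 (i) / [FrdI] Def. 1.3) — the `C^ℝ`-twin of
`Ex33ii_isFrobenioid_holds π hDc hDe` (seat abc-iut-L1-t6), usable by every `C^ℝ`-slot closer that needs the
[FrdI] §1 theory of Frobenioids on `C^rlf` (e.g. Prop. 1.13 rigidity/slimness, Prop. 1.9 isotropic hulls).

Classical ([FrdI], [FrdII] §3 are refereed preparatory papers); nothing here takes a side on [IUTchIII] Cor. 3.12.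
-/

noncomputable section

namespace Literature.AlgebraicGeometry.Frobenioids

open CategoryTheory Opposite Literature.AnabelianGeometry.EtaleTheta
open scoped NNReal

universe v u

namespace ArchFrd

namespace Thm36Sub

variable {D : Type u} [Category.{v} D] (π : D ⥤ D0)

/-! ### The hypotheses of [FrdI] Thm. 5.2 for the realified archimedean data -/

/-- **`Φ^rlf` is a monoid on `D`** for the archimedean `Φ = ℝ_{≥0}`: its pull-backs are identities
(`rlfFunctor_Φ_map_apply`), hence characteristically injective (`Φ^rlf(X)` is sharp) and bijective.
[cite: MochizukiFrdI2008, Def. 1.1 (ii) p.20] -/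
theorem isMonoidOn_rlfFunctor_Φ :
    IsMonoidOn (rlfFunctor (Φ π) (PreFrobenioid.IsPerfFactorialOn.op (isPerfFactorialOn_Φ π))) := by
  have hid : ∀ {A B : D} (α : B ⟶ A)
      (x : (rlfFunctor (Φ π) (PreFrobenioid.IsPerfFactorialOn.op (isPerfFactorialOn_Φ π))).obj (op A)),
      pull (rlfFunctor (Φ π) (PreFrobenioid.IsPerfFactorialOn.op (isPerfFactorialOn_Φ π))) α x = x :=
    fun α x => rlfFunctor_Φ_map_apply π α.op x
  have hinj : ∀ {A B : D} (α : B ⟶ A),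
      Function.Injective (pull (rlfFunctor (Φ π) (PreFrobenioid.IsPerfFactorialOn.op (isPerfFactorialOn_Φ π))) α) :=
    fun α a b h => by rwa [hid, hid] at h
  refine ⟨fun {A B} α => ?_, fun {A B} α _ => ⟨hinj α, fun y => ⟨y, hid α y⟩⟩⟩
  exact isCharInjective_of_injective_of_isSharp _ (hinj α)
    (IsPerfFactorial.Rlf.isSharp ((PreFrobenioid.IsPerfFactorialOn.op (isPerfFactorialOn_Φ π)) (op B)))

/-- In a group-like monoid any two elements are associated, so its monoid of associates has one element.
[cite: MochizukiFrdI2008, §0 p.11] -/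
theorem associates_eq_of_isUnit {M : Type*} [CommMonoid M] (h : ∀ m : M, IsUnit m) (x y : Associates M) :
    x = y := by
  obtain ⟨a, rfl⟩ := Associates.mk_surjective x
  obtain ⟨b, rfl⟩ := Associates.mk_surjective y
  exact Associates.mk_eq_mk_iff_associated.mpr
    ((associated_one_iff_isUnit.mpr (h a)).trans (associated_one_iff_isUnit.mpr (h b)).symm)

/-- **`ℝ · Φ^birat` is a monoid on `D`** for the realified archimedean data: its pull-backs are the
restrictions of the identity maps `(Φ^rlf)^gp(f)` (`pullGp_rlf_eq`) between the FULL subgroups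
(`realSpan_carrier_eq_top`), hence bijective; characteristic injectivity is automatic for a group-like monoid.
[cite: MochizukiFrdI2008, Def. 1.1 (ii) p.20] -/
theorem isMonoidOn_realSpan :
    IsMonoidOn ((RealificationData.canonical (Φ π)
        (PreFrobenioid.IsPerfFactorialOn.op (isPerfFactorialOn_Φ π))).realSpan
      (PreFrobenioid.biratSubfunctor (C.toElem π))).toMonoid := by
  -- notation: `R` THE realification datum, `Ψ = ℝ · Φ^birat ⊆ (Φ^rlf)^gp`
  let R := RealificationData.canonical (Φ π) (PreFrobenioid.IsPerfFactorialOn.op (isPerfFactorialOn_Φ π))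
  let Ψ := R.realSpan (PreFrobenioid.biratSubfunctor (C.toElem π))
  -- the pull-backs of `Ψ.toMonoid` are the restrictions `Ψ.pullRestrict`, which do not move the values
  have hpull : ∀ {A B : D} (α : B ⟶ A), pull Ψ.toMonoid α = Ψ.pullRestrict α := fun α => rfl
  have hval : ∀ {A B : D} (α : B ⟶ A) (c : Ψ.carrier A), (Ψ.pullRestrict α c).1 = c.1 := fun α c => by
    exact pullGp_rlf_eq π α _
  have hinj : ∀ {A B : D} (α : B ⟶ A), Function.Injective (pull Ψ.toMonoid α) := by
    intro A B α a b h
    rw [hpull] at h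
    have h' := congrArg Subtype.val h
    have ha := hval α a
    have hb := hval α b
    exact Subtype.ext (ha.symm.trans (h'.trans hb))
  refine ⟨fun {A B} α => ⟨hinj α, fun x y _ => ?_⟩, fun {A B} α _ => ⟨hinj α, fun d => ?_⟩⟩
  · exact associates_eq_of_isUnit (fun m => Ψ.isUnit_toMonoid (op A) m) x y
  · -- surjectivity: the element of `ℝ · Φ^birat(A)` with the same value (the carrier at `A` is everything)
    have hmem : (show Algebra.GrothendieckGroup (R.rlf.obj (op A)) from (d : Ψ.carrier B).1) ∈ Ψ.carrier A := by
      have h := realSpan_carrier_eq_top π A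
      change Ψ.carrier A = ⊤ at h
      rw [h]; exact Subgroup.mem_top _
    refine ⟨(⟨_, hmem⟩ : Ψ.carrier A), ?_⟩
    rw [hpull]
    exact Subtype.ext (hval α _)

/-- **`C^ℝ = C^rlf` is a Frobenioid** ([FrdI] Prop. 5.3: "the model Frobenioid [cf. Theorem 5.2, (ii)]
associated to the divisor monoid `Φ^rlf` … and the rational function monoid `ℝ · Φ^birat`" — the tree's
`ModelFrobenioid.isFrobenioid`, Thm. 5.2 (ii), at the realified archimedean data, whose hypotheses are the two
lemmas above, `IsPerfFactorial.Rlf.isDivisorial` and `rlf_objectwise_isGroupLike`), for the archimedean `C`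
over a connected, totally epimorphic base. [cite: MochizukiFrdI2008, Prop. 5.3 p.103] -/
theorem rlf_isFrobenioid (hDc : IsGraphConnected D) (hDe : IsTotallyEpimorphic D) :
    PreFrobenioid.IsFrobenioid (rlfStr π) :=
  ModelFrobenioid.isFrobenioid (isMonoidOn_rlfFunctor_Φ π)
    (fun X => IsPerfFactorial.Rlf.isDivisorial ((PreFrobenioid.IsPerfFactorialOn.op (isPerfFactorialOn_Φ π)) (op X)))
    (isMonoidOn_realSpan π) (rlf_objectwise_isGroupLike π) hDc hDe

end Thm36Sub

end ArchFrd

end Literature.AlgebraicGeometry.Frobenioids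

end
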